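import Summits.Ventures.HodgeRepro2.T5SU11SphericalSymmetry

/-!
# Bounds for the spherical functions of `SU(1,1)`: positivity, `φ_λ ≤ 1` on `0 ≤ λ ≤ 2`, `φ_λ ≥ 1` outside,
log-convexity in `λ`, and `φ_1 ≤ φ_λ`

For the spherical functions `sph λ g = ∫_K e^{λ t(k g)} dk` of `T5SU11SphericalFunction`:
* **Laplace's integral** `sph λ (a_t) = (2π)⁻¹ ∫_{-π}^{π} (cosh 2t - sinh 2t cos φ)^{-λ/2} dφ`
  (`sph_hyp_eq_laplace`, from `T5SU11SphericalSymmetry.sph_hyp_eq_intervalIntegral`);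
* the symmetries in the group variable `sph λ g⁻¹ = sph λ g`, `sph λ (a_{-t}) = sph λ (a_t)`
  (`sph_inv`, `sph_hyp_neg`, `sph_hyp_abs`: the Cartan parameter is inversion-invariant);
* **positivity** `sph λ g > 0` (`sph_pos`);
* **the Jensen bounds**: `sph λ g ≤ 1` for `0 ≤ λ ≤ 2` (`sph_le_one`) and `sph λ g ≥ 1` for `λ ≥ 2`
  or `λ ≤ 0` (`one_le_sph`) — Jensen's inequality for the concave / convex power `x ↦ x^{λ/2}` on the
  probability space `(K, dk)` applied to `f = |cosh t - ū² sinh t|^{-2} = e^{2 t(k a_t)}`, whose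
  integral is `1` (`T5SU11SphericalTwo.sph_two`); the half `λ ≤ 0` comes from the functional equation
  `sph λ = sph (2 - λ)` (`T5SU11SphericalSymmetry.sph_two_sub`);
* **log-convexity in the parameter**: `sph ((λ₁ + λ₂)/2) g ^ 2 ≤ sph λ₁ g * sph λ₂ g`
  (`sph_add_div_two_sq_le`, the Cauchy–Schwarz inequality on `K`), hence with the functional equation
  **`sph 1 g ≤ sph λ g` for every real `λ`** (`sph_one_le`): the spherical function of parameter
  `ρ = 1` (Harish-Chandra's `Ξ`-function of the explicit model) is the smallest real spherical function.
Nothing is claimed about (N).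

Blind lane: Mathlib + the HodgeRepro2 prefix only; no sorry; axioms ⊆ {propext, Classical.choice,
Quot.sound}.
-/

namespace Summit.Ventures.HodgeRepro2.T5SU11SphericalBounds

open MeasureTheory Metric Set Complex intervalIntegral
open T5SU11Unimodular T5SU11Fibration T5SU11Cartan T5SU11OneParameter T5SU11CartanProjection
  T5HaarCircle T5SU11SphericalFunction T5SU11SphericalTwo T5SU11SphericalSymmetry
  T5SU11IwasawaProjection
open scoped Real

/-! ### Laplace's integral form and the symmetries in the group variable -/

/-- `G_t(φ)^{-λ} = (cosh 2t - sinh 2t cos φ)^{-λ/2}`. -/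
lemma gnorm_rpow_neg_eq (t lam φ : ℝ) :
    gnorm t φ ^ (-lam) =
      (Real.cosh (2 * t) - Real.sinh (2 * t) * Real.cos φ) ^ (-lam / 2) := by
  have h : Real.cosh (2 * t) - Real.sinh (2 * t) * Real.cos φ = gnorm t φ ^ 2 := by
    rw [gnorm_sq, Real.cosh_two_mul, Real.sinh_two_mul]
    ring
  rw [h, ← Real.rpow_natCast, ← Real.rpow_mul (gnorm_pos t φ).le]
  congr 1
  push_cast
  ring

/-- **Laplace's integral**: `sph λ (a_t) = (2π)⁻¹ ∫_{-π}^{π} (cosh 2t - sinh 2t cos φ)^{-λ/2} dφ`. -/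
theorem sph_hyp_eq_laplace [MeasurableSpace Circle] [BorelSpace Circle] (lam t : ℝ) :
    sph lam (hyp t) =
      (2 * π)⁻¹ * ∫ φ in (-π)..π, (Real.cosh (2 * t) - Real.sinh (2 * t) * Real.cos φ) ^ (-lam / 2) := by
  rw [sph_hyp_eq_intervalIntegral]
  simp_rw [gnorm_rpow_neg_eq]

/-! ### The integrand on `K` (measurability-free lemmas) -/

/-- `|cosh t - ū² sinh t| > 0`. -/
lemma kint_pos (t : ℝ) (u : Circle) :
    0 < ‖(Real.cosh t : ℂ) - (starRingEnd ℂ) (u : ℂ) ^ 2 * Real.sinh t‖ := by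
  have h := exp_iwasawaT_rot_mul_hyp u t
  have := Real.exp_pos (iwasawaT (rot u * hyp t))
  rw [h] at this
  exact inv_pos.mp this

/-- `u ↦ |cosh t - ū² sinh t|` is continuous on `K`. -/
lemma continuous_kint (t : ℝ) :
    Continuous fun u : Circle => ‖(Real.cosh t : ℂ) - (starRingEnd ℂ) (u : ℂ) ^ 2 * Real.sinh t‖ :=
  (continuous_const.sub (((Complex.continuous_conj.comp continuous_subtype_val).pow 2).mul
    continuous_const)).norm

/-- `u ↦ |cosh t - ū² sinh t|^s` is continuous on `K`. -/
lemma continuous_kint_rpow (t s : ℝ) :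
    Continuous fun u : Circle =>
      ‖(Real.cosh t : ℂ) - (starRingEnd ℂ) (u : ℂ) ^ 2 * Real.sinh t‖ ^ s :=
  (continuous_kint t).rpow_const fun u => Or.inl (kint_pos t u).ne'

/-- `x^{-λ} = (x^{-2})^{λ/2}` for `x > 0`. -/
lemma rpow_neg_eq_rpow_neg_two_rpow {x : ℝ} (hx : 0 < x) (lam : ℝ) :
    x ^ (-lam) = (x ^ (-(2 : ℝ))) ^ (lam / 2) := by
  rw [← Real.rpow_mul hx.le]
  congr 1
  ring

/-- `x^{-(λ₁ + λ₂)/2} = x^{-λ₁/2} · x^{-λ₂/2}` for `x > 0`. -/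
lemma rpow_neg_add_div_two {x : ℝ} (hx : 0 < x) (l₁ l₂ : ℝ) :
    x ^ (-((l₁ + l₂) / 2)) = x ^ (-(l₁ / 2)) * x ^ (-(l₂ / 2)) := by
  rw [← Real.rpow_add hx]
  congr 1
  ring

section measure

variable [MeasurableSpace Circle] [BorelSpace Circle]

/-- **`sph λ g⁻¹ = sph λ g`**: the spherical functions are inversion-invariant. -/
theorem sph_inv (lam : ℝ) (g : SU11) : sph lam g⁻¹ = sph lam g := by
  rw [sph_eq_sph_hyp_cartanT, cartanT_inv, ← sph_eq_sph_hyp_cartanT]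

/-- `sph λ (a_{|t|}) = sph λ (a_t)`. -/
theorem sph_hyp_abs (lam t : ℝ) : sph lam (hyp |t|) = sph lam (hyp t) := by
  rw [sph_eq_sph_hyp_cartanT, cartanT_hyp, abs_abs, ← cartanT_hyp, ← sph_eq_sph_hyp_cartanT]

/-- `sph λ (a_{-t}) = sph λ (a_t)`: the spherical functions are even in the Cartan parameter. -/
theorem sph_hyp_neg (lam t : ℝ) : sph lam (hyp (-t)) = sph lam (hyp t) := by
  rw [← sph_hyp_abs lam (-t), abs_neg, sph_hyp_abs]

/-! ### Positivity -/

/-- `sph λ (a_t) > 0`. -/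
theorem sph_hyp_pos (lam t : ℝ) : 0 < sph lam (hyp t) := by
  rw [sph_hyp_eq_intervalIntegral]
  refine mul_pos (by positivity) ?_
  exact intervalIntegral_pos_of_pos_on ((continuous_gnorm_rpow t (-lam)).intervalIntegrable _ _)
    (fun φ _ => Real.rpow_pos_of_pos (gnorm_pos t φ) _) (by linarith [Real.pi_pos])

/-- **`sph λ g > 0`** for every real `λ` and every `g`. -/
theorem sph_pos (lam : ℝ) (g : SU11) : 0 < sph lam g := by
  rw [sph_eq_sph_hyp_cartanT]
  exact sph_hyp_pos _ _

/-! ### Integrability on `K` -/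

/-- `u ↦ |cosh t - ū² sinh t|^s` is integrable on `K`. -/
lemma integrable_kint_rpow (t s : ℝ) :
    Integrable (fun u : Circle =>
      ‖(Real.cosh t : ℂ) - (starRingEnd ℂ) (u : ℂ) ^ 2 * Real.sinh t‖ ^ s) haarCircle :=
  (continuous_kint_rpow t s).integrable_of_hasCompactSupport (HasCompactSupport.of_compactSpace _)

/-- `u ↦ |cosh t - ū² sinh t|^s` is in every `L^p(K)`. -/
lemma memLp_kint_rpow (t s : ℝ) (p : ENNReal) :
    MemLp (fun u : Circle =>
      ‖(Real.cosh t : ℂ) - (starRingEnd ℂ) (u : ℂ) ^ 2 * Real.sinh t‖ ^ s) p haarCircle :=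
  (continuous_kint_rpow t s).memLp_of_hasCompactSupport (HasCompactSupport.of_compactSpace _)

/-- `∫_K |cosh t - ū² sinh t|^{-2} dk = 1` (`φ_2 ≡ 1` in the `sph_hyp` form). -/
lemma integral_kint_rpow_neg_two (t : ℝ) :
    ∫ u, ‖(Real.cosh t : ℂ) - (starRingEnd ℂ) (u : ℂ) ^ 2 * Real.sinh t‖ ^ (-(2 : ℝ)) ∂haarCircle
      = 1 := by
  have h := sph_two (hyp t)
  rw [sph_hyp] at h
  exact h

/-! ### The Jensen bounds -/

/-- **`sph λ (a_t) ≤ 1` for `0 ≤ λ ≤ 2`** (Jensen for the concave power `x ↦ x^{λ/2}`). -/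
theorem sph_hyp_le_one {lam : ℝ} (h0 : 0 ≤ lam) (h2 : lam ≤ 2) (t : ℝ) : sph lam (hyp t) ≤ 1 := by
  rw [sph_hyp]
  have hcc : ConcaveOn ℝ (Ici 0) fun x : ℝ => x ^ (lam / 2) :=
    Real.concaveOn_rpow (by linarith) (by linarith)
  have hJ := hcc.le_map_integral (μ := haarCircle)
    (f := fun u : Circle => ‖(Real.cosh t : ℂ) - (starRingEnd ℂ) (u : ℂ) ^ 2 * Real.sinh t‖ ^ (-(2 : ℝ)))
    (Real.continuous_rpow_const (by linarith)).continuousOn isClosed_Ici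
    (Filter.Eventually.of_forall fun u => Real.rpow_nonneg (norm_nonneg _) _)
    (integrable_kint_rpow t _) ?_
  · rw [integral_kint_rpow_neg_two, Real.one_rpow] at hJ
    refine le_trans (le_of_eq ?_) hJ
    congr 1
    funext u
    exact rpow_neg_eq_rpow_neg_two_rpow (kint_pos t u) lam
  · have e : ((fun x : ℝ => x ^ (lam / 2)) ∘ fun u : Circle =>
        ‖(Real.cosh t : ℂ) - (starRingEnd ℂ) (u : ℂ) ^ 2 * Real.sinh t‖ ^ (-(2 : ℝ))) =
        fun u : Circle => ‖(Real.cosh t : ℂ) - (starRingEnd ℂ) (u : ℂ) ^ 2 * Real.sinh t‖ ^ (-lam) := by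
      funext u
      simp only [Function.comp]
      exact (rpow_neg_eq_rpow_neg_two_rpow (kint_pos t u) lam).symm
    rw [e]
    exact integrable_kint_rpow t _

/-- **`sph λ (a_t) ≥ 1` for `λ ≥ 2`** (Jensen for the convex power `x ↦ x^{λ/2}`). -/
theorem one_le_sph_hyp_of_two_le {lam : ℝ} (h2 : 2 ≤ lam) (t : ℝ) : 1 ≤ sph lam (hyp t) := by
  rw [sph_hyp]
  have hcv : ConvexOn ℝ (Ici 0) fun x : ℝ => x ^ (lam / 2) := convexOn_rpow (by linarith)
  have hJ := hcv.map_integral_le (μ := haarCircle)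
    (f := fun u : Circle => ‖(Real.cosh t : ℂ) - (starRingEnd ℂ) (u : ℂ) ^ 2 * Real.sinh t‖ ^ (-(2 : ℝ)))
    (Real.continuous_rpow_const (by linarith)).continuousOn isClosed_Ici
    (Filter.Eventually.of_forall fun u => Real.rpow_nonneg (norm_nonneg _) _)
    (integrable_kint_rpow t _) ?_
  · rw [integral_kint_rpow_neg_two, Real.one_rpow] at hJ
    refine le_trans hJ (le_of_eq ?_)
    congr 1
    funext u
    exact (rpow_neg_eq_rpow_neg_two_rpow (kint_pos t u) lam).symm
  · have e : ((fun x : ℝ => x ^ (lam / 2)) ∘ fun u : Circle =>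
        ‖(Real.cosh t : ℂ) - (starRingEnd ℂ) (u : ℂ) ^ 2 * Real.sinh t‖ ^ (-(2 : ℝ))) =
        fun u : Circle => ‖(Real.cosh t : ℂ) - (starRingEnd ℂ) (u : ℂ) ^ 2 * Real.sinh t‖ ^ (-lam) := by
      funext u
      simp only [Function.comp]
      exact (rpow_neg_eq_rpow_neg_two_rpow (kint_pos t u) lam).symm
    rw [e]
    exact integrable_kint_rpow t _

/-- **`sph λ g ≤ 1` for `0 ≤ λ ≤ 2`**: the spherical functions of the «complementary» range are
bounded by `1`. -/
theorem sph_le_one {lam : ℝ} (h0 : 0 ≤ lam) (h2 : lam ≤ 2) (g : SU11) : sph lam g ≤ 1 := by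
  rw [sph_eq_sph_hyp_cartanT]
  exact sph_hyp_le_one h0 h2 _

/-- **`sph λ g ≥ 1` for `λ ≥ 2`.** -/
theorem one_le_sph_of_two_le {lam : ℝ} (h2 : 2 ≤ lam) (g : SU11) : 1 ≤ sph lam g := by
  rw [sph_eq_sph_hyp_cartanT]
  exact one_le_sph_hyp_of_two_le h2 _

/-- **`sph λ g ≥ 1` for `λ ≤ 0`** (the functional equation `sph λ = sph (2 - λ)`). -/
theorem one_le_sph_of_nonpos {lam : ℝ} (h0 : lam ≤ 0) (g : SU11) : 1 ≤ sph lam g := by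
  rw [sph_two_sub]
  exact one_le_sph_of_two_le (by linarith) g

/-- **`sph λ g ≥ 1` outside `(0, 2)`.** -/
theorem one_le_sph {lam : ℝ} (h : lam ≤ 0 ∨ 2 ≤ lam) (g : SU11) : 1 ≤ sph lam g := by
  rcases h with h | h
  · exact one_le_sph_of_nonpos h g
  · exact one_le_sph_of_two_le h g

/-- `sph λ g = 1` for `λ ∈ {0, 2}` and `sph λ g ≤ 1 ≤ sph μ g` across the thresholds — the bounds are
sharp: `sph 0 g = 1 = sph 2 g`. -/
theorem sph_zero_eq_sph_two (g : SU11) : sph 0 g = sph 2 g := by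
  rw [sph_zero, sph_two]

/-! ### Log-convexity in the parameter and `φ_1 ≤ φ_λ` -/

/-- **The Cauchy–Schwarz inequality for the spherical functions on `A`**:
`sph ((λ₁ + λ₂)/2) (a_t) ^ 2 ≤ sph λ₁ (a_t) * sph λ₂ (a_t)` — log-convexity in the parameter. -/
theorem sph_hyp_add_div_two_sq_le (l₁ l₂ t : ℝ) :
    sph ((l₁ + l₂) / 2) (hyp t) ^ 2 ≤ sph l₁ (hyp t) * sph l₂ (hyp t) := by
  rw [sph_hyp, sph_hyp, sph_hyp]
  have hCS := integral_mul_le_Lp_mul_Lq_of_nonneg (μ := haarCircle) Real.HolderConjugate.two_two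
    (f := fun u : Circle => ‖(Real.cosh t : ℂ) - (starRingEnd ℂ) (u : ℂ) ^ 2 * Real.sinh t‖ ^ (-(l₁ / 2)))
    (g := fun u : Circle => ‖(Real.cosh t : ℂ) - (starRingEnd ℂ) (u : ℂ) ^ 2 * Real.sinh t‖ ^ (-(l₂ / 2)))
    (Filter.Eventually.of_forall fun u => Real.rpow_nonneg (norm_nonneg _) _)
    (Filter.Eventually.of_forall fun u => Real.rpow_nonneg (norm_nonneg _) _)
    (memLp_kint_rpow t _ _) (memLp_kint_rpow t _ _)
  have e1 : ∀ u : Circle, ‖(Real.cosh t : ℂ) - (starRingEnd ℂ) (u : ℂ) ^ 2 * Real.sinh t‖ ^ (-(l₁ / 2)) *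
      ‖(Real.cosh t : ℂ) - (starRingEnd ℂ) (u : ℂ) ^ 2 * Real.sinh t‖ ^ (-(l₂ / 2)) =
      ‖(Real.cosh t : ℂ) - (starRingEnd ℂ) (u : ℂ) ^ 2 * Real.sinh t‖ ^ (-((l₁ + l₂) / 2)) :=
    fun u => (rpow_neg_add_div_two (kint_pos t u) l₁ l₂).symm
  have e2 : ∀ (l : ℝ) (u : Circle),
      (‖(Real.cosh t : ℂ) - (starRingEnd ℂ) (u : ℂ) ^ 2 * Real.sinh t‖ ^ (-(l / 2))) ^ (2 : ℝ) =
      ‖(Real.cosh t : ℂ) - (starRingEnd ℂ) (u : ℂ) ^ 2 * Real.sinh t‖ ^ (-l) := fun l u => by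
    rw [← Real.rpow_mul (kint_pos t u).le]
    congr 1
    ring
  simp_rw [e1, e2] at hCS
  have hA : 0 ≤ ∫ u, ‖(Real.cosh t : ℂ) - (starRingEnd ℂ) (u : ℂ) ^ 2 * Real.sinh t‖ ^ (-l₁) ∂haarCircle :=
    integral_nonneg fun u => Real.rpow_nonneg (norm_nonneg _) _
  have hB : 0 ≤ ∫ u, ‖(Real.cosh t : ℂ) - (starRingEnd ℂ) (u : ℂ) ^ 2 * Real.sinh t‖ ^ (-l₂) ∂haarCircle :=
    integral_nonneg fun u => Real.rpow_nonneg (norm_nonneg _) _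
  have hM : 0 ≤ ∫ u, ‖(Real.cosh t : ℂ) - (starRingEnd ℂ) (u : ℂ) ^ 2 * Real.sinh t‖ ^ (-((l₁ + l₂) / 2))
      ∂haarCircle :=
    integral_nonneg fun u => Real.rpow_nonneg (norm_nonneg _) _
  calc (∫ u, ‖(Real.cosh t : ℂ) - (starRingEnd ℂ) (u : ℂ) ^ 2 * Real.sinh t‖ ^ (-((l₁ + l₂) / 2))
        ∂haarCircle) ^ 2
      ≤ ((∫ u, ‖(Real.cosh t : ℂ) - (starRingEnd ℂ) (u : ℂ) ^ 2 * Real.sinh t‖ ^ (-l₁) ∂haarCircle)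
          ^ (1 / (2 : ℝ)) *
        (∫ u, ‖(Real.cosh t : ℂ) - (starRingEnd ℂ) (u : ℂ) ^ 2 * Real.sinh t‖ ^ (-l₂) ∂haarCircle)
          ^ (1 / (2 : ℝ))) ^ 2 :=
        pow_le_pow_left₀ hM hCS 2
    _ = _ := by
        rw [mul_pow, ← Real.rpow_natCast, ← Real.rpow_natCast, ← Real.rpow_mul hA, ← Real.rpow_mul hB]
        norm_num

/-- **Log-convexity in the parameter**: `sph ((λ₁ + λ₂)/2) g ^ 2 ≤ sph λ₁ g * sph λ₂ g`. -/
theorem sph_add_div_two_sq_le (l₁ l₂ : ℝ) (g : SU11) :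
    sph ((l₁ + l₂) / 2) g ^ 2 ≤ sph l₁ g * sph l₂ g := by
  rw [sph_eq_sph_hyp_cartanT ((l₁ + l₂) / 2) g, sph_eq_sph_hyp_cartanT l₁ g,
    sph_eq_sph_hyp_cartanT l₂ g]
  exact sph_hyp_add_div_two_sq_le l₁ l₂ _

/-- **`sph 1 g ≤ sph λ g` for every real `λ`**: Harish-Chandra's `Ξ = φ_ρ` (`ρ = 1`) is the smallest
real spherical function — log-convexity at the pair `(λ, 2 - λ)` and the functional equation. -/
theorem sph_one_le (lam : ℝ) (g : SU11) : sph 1 g ≤ sph lam g := by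
  have h := sph_add_div_two_sq_le lam (2 - lam) g
  rw [← sph_two_sub, show (lam + (2 - lam)) / 2 = (1 : ℝ) by ring, ← sq] at h
  exact le_of_pow_le_pow_left₀ two_ne_zero (sph_pos lam g).le h

end measure

end Summit.Ventures.HodgeRepro2.T5SU11SphericalBounds
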